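import Literature.IUT.HodgeTheaters.PuncturedEllipticGeomOrigin
import Literature.AnabelianGeometry.AbsoluteAnabelian.FreeProSigmaCompletionBridge
import Mathlib.Tactic.Group
import HarnessLib

/-!
# [IUTchI] §1 p. 37: the geometric ORIGIN RECORD extended by the elliptic involution — `Δ_C = Δ_X ⋊ ⟨ι⟩`, `ι` inverting
# the two free generators (L5 ROWS #7 R46 «GEOMORIGIN-IOTA-FIELD»)

Mochizuki, *Inter-universal Teichmüller theory I*, kurims manuscript (May 2020), §1 p. 37 l. 6–10 ("`X` a hyperbolic curve of
type `(1,1)` over a field `k` of characteristic zero; `C` … whose `k`-core `C` [cf. [CanLift], Remark 2.1.1; [EtTh], the discussion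
at the beginning of §2] also forms a `k`-core of `X`" — `C = X/{±1}`, the quotient by the elliptic involution) [cite: Mochizuki2012,
IUTchI §1 p.37]; Mochizuki, *The étale theta function …* [EtTh], §2 Def. 2.1 p. 33 and the discussion preceding it (the stack
quotient of a once-punctured elliptic curve by `−1`, "semi-elliptic orbicurve") [cite: MochizukiEtTh2009, Def 2.1 p.33].

DEFINITION file (cell abc-iut, seat abc-iut-L5-t1 gen 11 = the `PuncturedEllipticData` / `GeomOrigin` lineage; abc-iut-L5-lead
RULINGS #118 (2) «t1 g11: GO R46 = the ONE extra GeomOrigin origin field abc-iut-L5-d4 asked for (Δ_C = Δ_X ⋊ ⟨ι⟩, ι inverting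
the generators up to Δ_X-conjugacy), as an EXTENSION record»).  An EXTENSION of the reviewed record `GeomOrigin` (p495678,
untouched): classically `Δ_C ≅ (ℤ/2 ∗ ℤ/2 ∗ ℤ/2)^ = ⟨t₁, t₂, t₃⟩`, `Δ_X` its even part, free profinite on `a = t₁t₂`,
`b = t₂t₃`, and the involution `ι = t₂ ∈ Δ_C ∖ Δ_X` satisfies `ι a ι⁻¹ = a⁻¹`, `ι b ι⁻¹ = b⁻¹` EXACTLY — so the record posits
generators `gens` (fields of `GeomOrigin`) together with such an `ι`:
* `PuncturedEllipticData.GeomOriginIota D` — `extends GeomOrigin D` by (i) `iota ∈ Δ_C`, `iota ∉ Π_X`, `iota² = 1`,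
  `iota · gens i · iota⁻¹ = (gens i)⁻¹` (`i = 0, 1`);
* §2 (proof-only, XS): `iota_conj_mem_deltaX` (`ι Δ_X ι⁻¹ = Δ_X`), `mul_iota_mem_deltaX` (every `c ∈ Δ_C ∖ Π_X` is `x·ι`
  with `x = c ι ∈ Δ_X`: `Δ_C = Δ_X ⊔ Δ_X ι`), and the abelianised form abc-iut-L5-d4's shadow descent consumes —
  `iota_conj_mul_mem_closure_commutator`: **`ι x ι⁻¹ · x ∈ ⁅Δ_X, Δ_X⁆⁻` for every `x ∈ Δ_X`** («`ι` acts by `−1` on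
  `Δ_X^{ab}`»: the set of such `x` is a closed subgroup of `Δ_X` containing `a, b`, which generate a dense subgroup by
  abc-iut-L4's `IsFreeProOn.dense_range_lift`).
NOT in this record (kept as displayed binders elsewhere): cusp `k`-rationality (r) of `PuncturedEllipticCoveringsCor12InertiaCentralOfStar`
(p500241) and the `Δ_ε` label clauses (L2a)(L2c)(L3) (RULINGS #118 (2): proof-step recollections, route DERIVE R45).

HONEST FRAMING: a hypothesis/ORIGIN record, asserted for no instance; no instance, no notation, no `Prop`-valued `def`;
nothing here bears on [IUTchIII] Cor. 3.12 or asserts that abc is proved or refuted; typed ≠ inhabited ≠ discharged.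
-/

noncomputable section

namespace Literature.IUT.HodgeTheaters

namespace PuncturedEllipticData

open scoped Pointwise
open Literature.AnabelianGeometry.AbsoluteAnabelian

universe u

variable {D : PuncturedEllipticData.{u}}

/-- **The geometric origin record WITH the elliptic involution** ([IUTchI] §1 p. 37 l. 6–10, `C = X/{±1}` the `k`-core;
[EtTh] §2): `GeomOrigin` (free generators `a, b` of `Δ_X`, commutator cusps, torsion-generated `Δ_C`) extended by an
involution `ι ∈ Δ_C ∖ Π_X` with `ι a ι⁻¹ = a⁻¹`, `ι b ι⁻¹ = b⁻¹` — so `Δ_C = Δ_X ⋊ ⟨ι⟩` (classically `Δ_C = ⟨t₁,t₂,t₃ | tᵢ² = 1⟩^`,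
`a = t₁t₂`, `b = t₂t₃`, `ι = t₂`).  A HYPOTHESIS record, asserted for no datum (abc-iut-L5-d4's request 2026-08-27, R46).
[cite: Mochizuki2012, IUTchI §1 p.37] -/
structure GeomOriginIota (D : PuncturedEllipticData.{u}) extends GeomOrigin D where
  /-- (i) a lift `ι ∈ Δ_C` of the elliptic involution `−1 ∈ Gal(X/C)` … -/
  iota : D.PiC
  /-- … lying in `Δ_C` … -/
  iota_mem_deltaC : iota ∈ D.DeltaC
  /-- … outside `Π_X` (it generates `Gal(X/C) = Π_C/Π_X ≅ ℤ/2`) … -/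
  iota_not_mem_piX : iota ∉ D.PiX
  /-- … of order `2` (an orbifold point of `C`) … -/
  iota_mul_self : iota * iota = 1
  /-- … and inverting the two free generators: `ι a ι⁻¹ = a⁻¹`, `ι b ι⁻¹ = b⁻¹`. -/
  iota_conj_gens : ∀ i : Fin 2, iota * (gens i : D.PiC) * iota⁻¹ = ((gens i : D.PiC))⁻¹

namespace GeomOriginIota

/-! ### §2. Immediate consequences (proof-only) -/

/-- `ι` normalises `Δ_X = Π_X ∩ Δ_C` (both factors are normal in `Π_C`). ([IUTchI] §1 p.37) [claim: Mochizuki2012, status: disputed] -/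
theorem iota_conj_mem_deltaX (O : D.GeomOriginIota) {x : D.PiC} (hx : x ∈ D.PiX ⊓ D.DeltaC) :
    O.iota * x * O.iota⁻¹ ∈ D.PiX ⊓ D.DeltaC :=
  ⟨D.piX_normal.conj_mem x hx.1 O.iota, D.E.normal_geom.conj_mem x hx.2 O.iota⟩

/-- `Δ_C = Δ_X ⊔ Δ_X·ι`: an element of `Δ_C` outside `Π_X` is `x·ι` with `x := c·ι ∈ Δ_X` (`[Π_C : Π_X] = 2`, `ι² = 1`).
([IUTchI] §1 p.37) [claim: Mochizuki2012, status: disputed] -/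
theorem mul_iota_mem_deltaX (O : D.GeomOriginIota) {c : D.PiC} (hc : c ∈ D.DeltaC) (hcX : c ∉ D.PiX) :
    c * O.iota ∈ D.PiX ⊓ D.DeltaC :=
  ⟨(Subgroup.mul_mem_iff_of_index_two D.index_piX).mpr (iff_of_false hcX O.iota_not_mem_piX),
    mul_mem hc O.iota_mem_deltaC⟩

/-- `c = (c·ι)·ι` for `ι² = 1`. ([IUTchI] §1 p.37) [claim: Mochizuki2012, status: disputed] -/
theorem eq_mul_iota_mul_iota (O : D.GeomOriginIota) (c : D.PiC) : c = c * O.iota * O.iota := by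
  rw [mul_assoc, O.iota_mul_self, mul_one]

/-- **`ι` acts by `−1` on `Δ_X^{ab}`**: `ι x ι⁻¹ · x ∈ ⁅Δ_X, Δ_X⁆⁻` for every `x ∈ Δ_X` — the set of such `x` is a closed
subgroup of `Δ_X` (closed under products modulo commutators, by normality of `⁅Δ_X,Δ_X⁆⁻`) containing the free generators
(`ι a ι⁻¹ a = 1`), which generate a dense subgroup (`IsFreeProOn.dense_range_lift`). ([IUTchI] §1 p.37)
[claim: Mochizuki2012, status: disputed] -/
theorem iota_conj_mul_mem_closure_commutator (O : D.GeomOriginIota) {x : D.PiC} (hx : x ∈ D.PiX ⊓ D.DeltaC) :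
    O.iota * x * O.iota⁻¹ * x ∈ (⁅D.PiX ⊓ D.DeltaC, D.PiX ⊓ D.DeltaC⁆).topologicalClosure := by
  classical
  haveI hΔn : (D.PiX ⊓ D.DeltaC).Normal := by
    haveI := D.piX_normal
    haveI : D.DeltaC.Normal := D.E.normal_geom
    exact Subgroup.normal_inf_normal D.PiX D.DeltaC
  haveI hNn : (⁅D.PiX ⊓ D.DeltaC, D.PiX ⊓ D.DeltaC⁆).topologicalClosure.Normal :=
    Subgroup.is_normal_topologicalClosure _
  have hΔc : IsClosed ((D.PiX ⊓ D.DeltaC : Subgroup D.PiC) : Set D.PiC) := D.isClosed_piX_inf_deltaC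
  set ι := O.iota with hι
  set N := (⁅D.PiX ⊓ D.DeltaC, D.PiX ⊓ D.DeltaC⁆).topologicalClosure with hN
  -- the subgroup `T = {x ∈ Δ_X | ι x ι⁻¹ x ∈ N}` of `Δ_X`
  let T : Subgroup ↥(D.PiX ⊓ D.DeltaC) :=
    { carrier := {x | ι * (x : D.PiC) * ι⁻¹ * (x : D.PiC) ∈ N}
      one_mem' := by simp [N.one_mem]
      mul_mem' := by
        intro x y hx hy
        have hu : ι * (x : D.PiC) * ι⁻¹ ∈ D.PiX ⊓ D.DeltaC := O.iota_conj_mem_deltaX x.2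
        have hv : ι * (y : D.PiC) * ι⁻¹ ∈ D.PiX ⊓ D.DeltaC := O.iota_conj_mem_deltaX y.2
        have hc : (ι * (y : D.PiC) * ι⁻¹) * (x : D.PiC) * (ι * (y : D.PiC) * ι⁻¹)⁻¹ * (x : D.PiC)⁻¹ ∈ N :=
          Subgroup.le_topologicalClosure _ (Subgroup.commutator_mem_commutator hv x.2)
        have hid : ι * ((x * y : ↥(D.PiX ⊓ D.DeltaC)) : D.PiC) * ι⁻¹ * ((x * y : ↥(D.PiX ⊓ D.DeltaC)) : D.PiC) =
            ((ι * (x : D.PiC) * ι⁻¹) * ((ι * (y : D.PiC) * ι⁻¹) * (x : D.PiC) * (ι * (y : D.PiC) * ι⁻¹)⁻¹ *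
              (x : D.PiC)⁻¹) * (ι * (x : D.PiC) * ι⁻¹)⁻¹) * (ι * (x : D.PiC) * ι⁻¹ * (x : D.PiC)) *
                (ι * (y : D.PiC) * ι⁻¹ * (y : D.PiC)) := by
          rw [Subgroup.coe_mul]; group
        change ι * ((x * y : ↥(D.PiX ⊓ D.DeltaC)) : D.PiC) * ι⁻¹ * ((x * y : ↥(D.PiX ⊓ D.DeltaC)) : D.PiC) ∈ N
        rw [hid]
        exact mul_mem (mul_mem (hNn.conj_mem _ hc _) hx) hy
      inv_mem' := by
        intro x hx
        have hid : ι * ((x⁻¹ : ↥(D.PiX ⊓ D.DeltaC)) : D.PiC) * ι⁻¹ * ((x⁻¹ : ↥(D.PiX ⊓ D.DeltaC)) : D.PiC) =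
            ((x : D.PiC) * (ι * (x : D.PiC) * ι⁻¹ * (x : D.PiC)) * (x : D.PiC)⁻¹)⁻¹ := by
          rw [Subgroup.coe_inv]; group
        change ι * ((x⁻¹ : ↥(D.PiX ⊓ D.DeltaC)) : D.PiC) * ι⁻¹ * ((x⁻¹ : ↥(D.PiX ⊓ D.DeltaC)) : D.PiC) ∈ N
        rw [hid]
        exact inv_mem (hNn.conj_mem _ hx _) }
  -- `T` is closed
  have hTc : IsClosed (T : Set ↥(D.PiX ⊓ D.DeltaC)) := by
    have hcont : Continuous fun x : ↥(D.PiX ⊓ D.DeltaC) => ι * (x : D.PiC) * ι⁻¹ * (x : D.PiC) :=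
      ((continuous_const.mul continuous_subtype_val).mul continuous_const).mul continuous_subtype_val
    exact (Subgroup.isClosed_topologicalClosure _).preimage hcont
  -- `T` contains the generators, hence the dense subgroup they generate, hence everything
  have hgens : ∀ i, O.gens i ∈ T := by
    intro i
    change ι * (O.gens i : D.PiC) * ι⁻¹ * (O.gens i : D.PiC) ∈ N
    rw [O.iota_conj_gens i, inv_mul_cancel]
    exact N.one_mem
  have hrange : (FreeGroup.lift O.gens).range ≤ T := by
    rw [FreeGroup.range_lift_eq_closure, Subgroup.closure_le]
    rintro _ ⟨i, rfl⟩
    exact hgens i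
  haveI : CompactSpace ↥(D.PiX ⊓ D.DeltaC) := isCompact_iff_compactSpace.mp hΔc.isCompact
  have hdense := O.isFreeProOn.dense_range_lift
  have hT : (⟨x, hx⟩ : ↥(D.PiX ⊓ D.DeltaC)) ∈ T := by
    have hsub : closure (Set.range (FreeGroup.lift O.gens)) ⊆ (T : Set ↥(D.PiX ⊓ D.DeltaC)) :=
      hTc.closure_subset_iff.mpr (by rintro _ ⟨w, rfl⟩; exact hrange ⟨w, rfl⟩)
    exact hsub (by rw [hdense.closure_eq]; exact Set.mem_univ _)
  exact hT

end GeomOriginIota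

end PuncturedEllipticData

end Literature.IUT.HodgeTheaters

end
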